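import Summits.ResolutionOfSingularities.ResolutionOfSingularities.Theorems.FrobeniusClosingSteerWords07SteeredLeaves
import Summits.ResolutionOfSingularities.ResolutionOfSingularities.Theorems.FrobeniusClosingSteerRunHygieneTwo
import Summits.ResolutionOfSingularities.ResolutionOfSingularities.Theorems.FrobeniusClosingSteerStrippedThreadLemmas
import Summits.ResolutionOfSingularities.ResolutionOfSingularities.Theorems.FrobeniusClosingSteerNoEternalChainCore
import Summits.ResolutionOfSingularities.ResolutionOfSingularities.Theorems.FrobeniusClosingSteerCompletionFrobeniusClosed
import Literature.AlgebraicGeometry.Resolution.RegularLocalRingsNormal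
import HarnessLib

/-!
# Crux `Steer` (stmt-ResolutionOfSingularities-16345), σ-line at `p = 2` — **(Σ) point steps recur** (Theses-free body of
# `PointStepsRecurTwoN`, res-L0-w41-plan-1 RULING 110b / 111a (2); statement owner res-D-pv-011, prover res-type-028 g10)

OURS (campaign `res-hironaka`, rung L ★L-G4, slot W4.1, chain w41); replaces the role of no printed item; NOT a statement of
the manuscript under review [claim: Hironaka2017, status: under-review]; AI seat, weaker than expert review.

**The fact (Σ).** Along an eternal σ_top-steered run `(R i, P i, s i)` of a core datum `(O, A₀, t)` at `p = 2`, `n = 4`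
(`R 0 = (A₀)_{𝔪_O ∩ A₀}`), if only finitely many steps are positive-dimensional of height `≥ 2`, then POINT STEPS RECUR:
beyond every stage there is a point step. Equivalently: the run cannot end in an eternal tail of DIVISOR steps (strips along
height-one centres).

**Proof (plan-1's 110b mechanism, one notch cheaper — no cleaned-order functional is needed).** Suppose no point step and no
height-`≥ 2` step happens from stage `i₂` on. Every member is a regular local ring (`Words.steeredMembersRegular_holds`) equal
to its own local ring at the centre of `O` (`IsLocalBlowup.locAtCentre_eq`), and every centre `P j`, `j ≥ i₂`, is a prime of
height exactly `1` (`StrippedThread.height_eq_one_of_isLocalBlowupAlong`), hence principal, so the local blowing up along it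
changes nothing: `R (j+1) = R j` (`StrippedThread.eq_locAtCentre_of_divisorStep`); by induction `R j = R i₂ =: S` for all
`j ≥ i₂`. The strict-transform steps `s j = x_j · s (j+1) + g_j` (`x_j ∈ P j`, `g_j ∈ R j`) now all live in `S`, with
`x_j ∈ 𝔪_S` (an element of value `1` would be a unit of `S = locAtCentre S O`, but `P j ≠ ⊤`), and in characteristic `2`
`f_{n+1} · x_n² = f_n − g_n²` for `f_n := (s (i₂+n))² ∈ S` — exactly the telescoping input of res-D-pv-011's K(1) core
`NoEternalChainOne.exists_frobenius_approx`: an `𝔪_S`-adic Cauchy sequence `c` with `f_0 − c_n² ∈ 𝔪_S^n`. `S` is excellent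
(a localisation of a finitely generated model, `SteeredExit.exists_model_of_tower` + `GeoDict.isExcellentRing_of_locChar`) and
integrally closed (regular), so `f_0 = (s i₂)²` is a square `d²` IN `S` (`CompletionFrobeniusClosed.exists_pow_eq_of_adicCauchy_of_isExcellentRing`),
whence `s i₂ = ±d ∈ R i₂` — contradicting run hygiene (`RunHygiene.runHygieneTwo_of_steeredRun`, clause (5): the generator
`s j` is never a fraction of elements of `R j`, from the core datum's regular / non-square / zero-dimensional / trdeg rows).
No isolatedness, no `H`, no rank or normalisation hypothesis is used.

The in-skeleton leaf `pointStepsRecurTwoN_holds : PointStepsRecurTwoN` (pv-011's verbatim Prop, r36/r37) is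
`intro …; subst hp; exact PointStepsRecur.pointSteps_recur_of_steeredRun O A₀ h₀ t core R P s hR0 hrun hfin i₀`
(`hfin : ¬ HeightTwoStepsInfinite R P` unfolds to the `Set.Infinite` hypothesis below; `HeightTwoStepsInfinite`, `NormalAt`,
`IsHighOrderAt` are not tree words yet, whence the hypothesis form). [cite: NovacoskiSpivakovsky2014, Def. 2.8 and Def. 2.11]
[cite: Matsumura1987, Thm. 19.4, Thm. 20.3, §32 p. 260] [folklore]
-/

-- The namespace mirrors the chain's helper layout (`…Theorems.SwitchingDichotomy.<Piece>`) on purpose.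
set_option linter.dupNamespace false

noncomputable section

namespace Summit.ResolutionOfSingularities.ResolutionOfSingularities.Theorems.SwitchingDichotomy.PointStepsRecur

open Polynomial IsLocalRing Literature.AlgebraicGeometry.Resolution
open Summit.ResolutionOfSingularities.ResolutionOfSingularities.Theorems.SwitchingDichotomy.Words

variable {K : Type} [Field K]

/-! ## 1. Two bookkeeping lemmas on local subrings dominated by `O` -/

/-- A LOCAL subring `S` of a field is its own localisation at the maximal ideal, in the `GeoDict` «locChar» currency: the
elements of `S` are exactly the fractions `a / b`, `a, b ∈ S`, `b ∉ 𝔪_S` (non-members of `𝔪_S` are units of `S`). [folklore] -/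
theorem locChar_self (S : Subring K) [IsLocalRing S] :
    ∀ z : K, z ∈ S ↔ ∃ a b : S, b ∉ maximalIdeal S ∧ z = (a : K) / b := by
  intro z
  constructor
  · intro hz
    refine ⟨⟨z, hz⟩, 1, ?_, by simp⟩
    exact fun h => (maximalIdeal.isMaximal S).ne_top (Ideal.eq_top_of_isUnit_mem _ h isUnit_one)
  · rintro ⟨a, b, hb, rfl⟩
    have hbu : IsUnit b := by
      by_contra h
      exact hb ((mem_maximalIdeal _).mpr h)
    obtain ⟨c, hbc⟩ := hbu.exists_right_inv
    have hbcK : (b : K) * (c : K) = 1 := by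
      have h := congrArg (fun z : S => (z : K)) hbc
      simpa using h
    have hinv : ((b : K))⁻¹ ∈ S := by
      rw [inv_eq_of_mul_eq_one_right hbcK]
      exact c.2
    rw [div_eq_mul_inv]
    exact S.mul_mem a.2 hinv

/-- In a subring `S ⊆ O` with `locAtCentre S O = S`, an element of a PROPER ideal has `O`-value `< 1` (an element of
value `1` has its inverse in `locAtCentre S O = S`, hence is a unit of `S`). [folklore] -/
theorem valuation_lt_one_of_mem_of_ne_top {O : ValuationSubring K} {S : Subring K} (hSO : S ≤ O.toSubring)
    (hloc : locAtCentre S O = S) {I : Ideal S} (hI : I ≠ ⊤) {x : K} (hx : x ∈ S) (hxI : (⟨x, hx⟩ : S) ∈ I) :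
    O.valuation x < 1 := by
  rcases ((O.valuation_le_one_iff x).mpr (hSO hx)).lt_or_eq with hlt | heq
  · exact hlt
  · exfalso
    have hx0 : x ≠ 0 := ne_zero_of_valuation_eq_one heq
    have hinv : x⁻¹ ∈ S := by
      have h := inv_mem_locAtCentre (le_locAtCentre S O hx) heq
      rwa [hloc] at h
    have hunit : IsUnit (⟨x, hx⟩ : S) :=
      ⟨⟨⟨x, hx⟩, ⟨x⁻¹, hinv⟩, Subtype.ext (mul_inv_cancel₀ hx0), Subtype.ext (inv_mul_cancel₀ hx0)⟩, rfl⟩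
    exact hI (I.eq_top_of_isUnit_mem hxI hunit)

/-! ## 2. (Σ) in hypothesis form -/

/-- **(Σ) · point steps recur** (Theses-free body of `PointStepsRecurTwoN`; plan-1 RULING 110b / 111a (2)): along an eternal
σ_top-steered run of a `CoreDatum 2 4` datum from `R 0 = (A₀)_{𝔪_O ∩ A₀}`, if the set of positive steps of height `≥ 2` is
finite (`¬ HeightTwoStepsInfinite R P`, unfolded), then beyond every stage `i₀` there is a POINT STEP (`IsPointStep R P i`,
unfolded). See the file header for the proof (eternal divisor tail in a fixed regular excellent member ⇒ the radicand is a
square there by Frobenius-closedness along the telescoped Cauchy sequence ⇒ the generator lies in the member, contradicting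
run hygiene). OURS. [cite: NovacoskiSpivakovsky2014, Def. 2.11] [cite: Matsumura1987, Thm. 20.3, §32 p. 260] [folklore] -/
theorem pointSteps_recur_of_steeredRun {k : Type} [Field k] [CharP k 2] [PerfectField k] [Algebra k K]
    (O : ValuationSubring K) (A₀ : Subalgebra k K) (h₀ : A₀.toSubring ≤ O.toSubring) (t : K)
    (core : CoreDatum 2 4 k K O A₀ h₀ t)
    (R : ℕ → Subring K) (P : (i : ℕ) → Ideal (R i)) (s : ℕ → K)
    (hR0 : R 0 = locAtCentre A₀.toSubring O) (hrun : IsSteeredRun O R P t 2 s)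
    (hfin : ¬ {j | (∃ _ : IsLocalRing (R j), P j ≠ maximalIdeal (R j)) ∧ 2 ≤ (P j).height}.Infinite)
    (i₀ : ℕ) : ∃ i, i₀ ≤ i ∧ ∃ _ : IsLocalRing (R i), P i = maximalIdeal (R i) := by
  classical
  haveI : CharP K 2 := charP_of_injective_algebraMap (algebraMap k K).injective 2
  haveI : Fact (Nat.Prime 2) := ⟨Nat.prime_two⟩
  by_contra hno
  push Not at hno
  -- ### the run's clauses
  have hs0 : s 0 = t := hrun.1
  haveI hRloc : ∀ i, IsLocalRing (R i) := fun i => (hrun.2 i).1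
  have hsp : ∀ i, s i ^ 2 ∈ R i := fun i => (hrun.2 i).2.1
  have hσ : ∀ i, IsSigmaTopCentre (R i) 2 ⟨s i ^ 2, hsp i⟩ (P i) := fun i => (hrun.2 i).2.2.1
  have hbl : ∀ i, IsLocalBlowupAlong O (R i) (P i) (R (i + 1)) := fun i => (hrun.2 i).2.2.2.1
  have hst : ∀ i, ∃ x g : K, ((∃ hx : x ∈ R i, (⟨x, hx⟩ : R i) ∈ P i) ∧ x ≠ 0 ∧
      ∀ y : R i, y ∈ P i → O.valuation (y : K) ≤ O.valuation x) ∧ g ∈ R i ∧ s i = x * s (i + 1) + g :=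
    fun i => (hrun.2 i).2.2.2.2
  -- ### core rows
  obtain ⟨hfg, htp, hfr, hreg, -, h0, hdim, -, -, -, -, hc, htr, -⟩ := id core
  -- ### members: between `A₀` and `O`, regular, their own local rings at the centre
  have hmem : ∀ j, A₀.toSubring ≤ R j ∧ R j ≤ O.toSubring := fun j =>
    MembersPerfectResidue.le_member_of_steps O A₀ h₀ R P j hR0 (fun i _ => hbl i) j le_rfl
  have hregR : ∀ j, IsRegularLocalRing (R j) := fun j =>
    steeredMembersRegular_holds 2 Nat.prime_two 4 le_rfl k K O A₀ h₀ t core R P s j hR0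
      ⟨hs0, fun i _ => hsp i, fun i _ => hrun.2 i⟩
  have hlocR : ∀ j, locAtCentre (R j) O = R j := by
    intro j
    cases j with
    | zero => rw [hR0, locAtCentre_locAtCentre]
    | succ j => exact (hbl j).isLocalBlowup.locAtCentre_eq
  -- ### the tail: from `i₂` on, no point step and no centre of height `≥ 2`
  obtain ⟨i₁, hi₁⟩ : ∃ i₁, ∀ j, i₁ ≤ j →
      ¬ ((∃ _ : IsLocalRing (R j), P j ≠ maximalIdeal (R j)) ∧ 2 ≤ (P j).height) := by
    obtain ⟨i₁, hi₁⟩ := (Set.not_infinite.mp hfin).bddAbove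
    refine ⟨i₁ + 1, fun j hj hj' => ?_⟩
    have := hi₁ hj'
    omega
  set i₂ : ℕ := max i₀ i₁ with hi₂def
  have hpos : ∀ j, i₂ ≤ j → P j ≠ maximalIdeal (R j) := fun j hj =>
    hno j (le_trans (le_max_left _ _) hj) (hRloc j)
  -- the centres of the tail are permissible (primes) of height exactly one
  have hperm : ∀ j, i₂ ≤ j → IsPermissibleCentre (R j) 2 ⟨s j ^ 2, hsp j⟩ (P j) := by
    intro j hj
    rcases hσ j with h | ⟨h, -, -⟩
    · exact h
    · exact absurd h (hpos j hj)
  have hprime : ∀ j, i₂ ≤ j → (P j).IsPrime := fun j hj => (hperm j hj).2.1.1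
  have hht : ∀ j, i₂ ≤ j → (P j).height = 1 := by
    intro j hj
    refine StrippedThread.height_eq_one_of_isLocalBlowupAlong (hbl j) ?_
    have h2 : ¬ 2 ≤ (P j).height := fun h2 =>
      hi₁ j (le_trans (le_max_right _ _) hj) ⟨⟨hRloc j, hpos j hj⟩, h2⟩
    exact ENat.lt_two_iff.mp (not_le.mp h2)
  -- ### the member is FIXED along the tail (divisor steps change nothing)
  have hstepEq : ∀ j, i₂ ≤ j → R (j + 1) = R j := by
    intro j hj
    haveI := hregR j
    haveI := hprime j hj
    rw [StrippedThread.eq_locAtCentre_of_divisorStep (hlocR j) (hht j hj) (hbl j), hlocR j]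
  have hconst : ∀ n, R (i₂ + n) = R i₂ := by
    intro n
    induction n with
    | zero => rfl
    | succ n ih =>
      show R (i₂ + n + 1) = R i₂
      rw [hstepEq (i₂ + n) (Nat.le_add_right _ _), ih]
  -- ### the fixed member `S := R i₂`: local, regular, excellent, integrally closed, of characteristic 2
  haveI hSreg : IsRegularLocalRing (R i₂) := hregR i₂
  haveI : IsIntegrallyClosed (R i₂) := isIntegrallyClosed_of_isRegularLocalRing (R i₂)
  have hSO : R i₂ ≤ O.toSubring := (hmem i₂).2
  have hexc : IsExcellentRing (R i₂) := by
    obtain ⟨A₁, -, -, hfg₁, hRA₁⟩ := SteeredExit.exists_model_of_tower O A₀ h₀ hfg hR0 (N := i₂)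
      (fun i _ => (hbl i).isLocalBlowup)
    exact GeoDict.isExcellentRing_of_locChar O A₁ hfg₁ hRA₁ (P := maximalIdeal (R i₂)) (locChar_self (R i₂))
  -- ### the Frobenius chain in `S`
  choose xx gg hxg using hst
  have hxR : ∀ i, xx i ∈ R i := fun i => (hxg i).1.1.1
  have hxP : ∀ i, (⟨xx i, hxR i⟩ : R i) ∈ P i := fun i => (hxg i).1.1.2
  have hgR : ∀ i, gg i ∈ R i := fun i => (hxg i).2.1
  have hsx : ∀ i, s i = xx i * s (i + 1) + gg i := fun i => (hxg i).2.2
  have hxS : ∀ n, xx (i₂ + n) ∈ R i₂ := fun n => by rw [← hconst n]; exact hxR _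
  have hgS : ∀ n, gg (i₂ + n) ∈ R i₂ := fun n => by rw [← hconst n]; exact hgR _
  have hfS : ∀ n, s (i₂ + n) ^ 2 ∈ R i₂ := fun n => by rw [← hconst n]; exact hsp _
  let f : ℕ → R i₂ := fun n => ⟨s (i₂ + n) ^ 2, hfS n⟩
  let g : ℕ → R i₂ := fun n => ⟨gg (i₂ + n), hgS n⟩
  let x : ℕ → R i₂ := fun n => ⟨xx (i₂ + n), hxS n⟩
  have hxv : ∀ n, O.valuation (xx (i₂ + n)) < 1 := fun n =>
    valuation_lt_one_of_mem_of_ne_top (hmem (i₂ + n)).2 (hlocR (i₂ + n))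
      (hprime (i₂ + n) (Nat.le_add_right _ _)).ne_top (hxR _) (hxP _)
  have hxm : ∀ n, x n ∈ maximalIdeal (R i₂) := fun n =>
    MembersPerfectResidue.mem_maximalIdeal_of_valuation_lt_one hSO (hxv n)
  have hrel : ∀ n, f (n + 1) * x n ^ 2 = f n - g n ^ 2 := by
    intro n
    apply Subtype.ext
    show s (i₂ + (n + 1)) ^ 2 * xx (i₂ + n) ^ 2 = s (i₂ + n) ^ 2 - gg (i₂ + n) ^ 2
    have h1 : s (i₂ + n) - gg (i₂ + n) = xx (i₂ + n) * s (i₂ + n + 1) := by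
      rw [hsx (i₂ + n)]; ring
    rw [← sub_pow_char (s (i₂ + n)) (gg (i₂ + n)), h1, mul_pow, mul_comm]
    rfl
  obtain ⟨c, hc1, hc2⟩ := NoEternalChainOne.exists_frobenius_approx 2 f g x hxm hrel
  obtain ⟨d, hd⟩ := CompletionFrobeniusClosed.exists_pow_eq_of_adicCauchy_of_isExcellentRing hexc 2 (f 0) c
    (fun n => by have h := Submodule.neg_mem _ (hc1 n); rwa [neg_sub] at h)
    (fun n => by have h := Submodule.neg_mem _ (hc2 n); rwa [neg_sub] at h)
  -- ### `s i₂ = ± d ∈ R i₂`, contradicting run hygiene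
  have hdK : s i₂ ^ 2 = ((d : R i₂) : K) ^ 2 := by
    have h := congrArg (fun z : R i₂ => (z : K)) hd
    simpa [f] using h.symm
  obtain ⟨-, -, -, -, h5, -⟩ := RunHygiene.runHygieneTwo_of_steeredRun O A₀ h₀ t hfg htp hfr hreg h0 hdim hc htr
    R P s hR0 hbl (fun i => ⟨xx i, gg i, hxg i⟩) hs0
  have h1 : (((1 : R i₂) : R i₂) : K) ≠ 0 := by simp
  rcases (sq_eq_sq_iff_eq_or_eq_neg).mp hdK with h | h
  · exact h5 i₂ d 1 h1 (by rw [Subring.coe_one, mul_one, h])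
  · exact h5 i₂ (-d) 1 h1 (by rw [Subring.coe_one, mul_one, h, Subring.coe_neg])

end Summit.ResolutionOfSingularities.ResolutionOfSingularities.Theorems.SwitchingDichotomy.PointStepsRecur

end
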